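import Literature.AlgebraicGeometry.Resolution.CobordantBlowupExtReesBridge
import HarnessLib

/-!
# (o25) «F-AQS-T in the kernel», piece (γ2) — PLUS-STALK, the factorisation brick: `f = (t⁻¹)ᵃ · (f tᵃ)` with `t⁻¹ ∤ f tᵃ`

Route `ResolutionOfSingularities/WeightedInvariant`, crux `Theses.WeightedInvariant.HypersurfaceCentreConstruction`
(stmt-ResolutionOfSingularities-19897), door line `local-engine`, rung `e = 1`, ORDER (o25) of res-L1-w43-plan-1, design of record
res-type-092's `O25-DESIGN.md` §2, piece (γ2) PLUS-STALK («… a factorisation `germ F = t⁻ᵃ g` (`t⁻¹ ∤ g`) …»; holder res-type-089).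
Sequel of `AQSHeightTwoPlusStalk.lean` (the order read-off holds for EVERY factorisation; the LOCAL DROP (β2)
`adicOrder_transform_lt` is stated for the `t⁻¹`-PRIMITIVE ones, so the consumer needs one to exist).

For a commutative ring `A`, a sequence of ideals `I` and the game ring `A[t⁻¹, Iₙ tⁿ] = extReesAlgebra I ⊆ A[t, t⁻¹]`:
* `extReesAlgebra.exists_eq_tInv_pow_mul_of_mem` — `f ∈ Iₐ` ⇒ `f = (t⁻¹)ᵃ · g` in the game ring with `g = f tᵃ`;
* `extReesAlgebra.C_mul_T_mem_iff` — for a descending multiplicative `I` (`I₀ = A`): `f tⁿ ∈ A[t⁻¹, Iₙ tⁿ] ↔ f ∈ Iₙ`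
  (the coefficientwise model, `IdealFiltration.extReesAlgebra_ideal_eq_extendedRees`);
* `extReesAlgebra.not_tInv_dvd_of_not_mem` — `f ∉ Iₐ₊₁` ⇒ `t⁻¹ ∤ f tᵃ`;
* `exists_mem_and_not_mem_succ` — if `f ∈ I₀` and `f ∉ Iₙ` for some `n`, some `a` has `f ∈ Iₐ`, `f ∉ Iₐ₊₁`;
* **`extReesAlgebra.exists_tInv_primitive_factorisation`** — hence a `t⁻¹`-PRIMITIVE factorisation `f = (t⁻¹)ᵃ g`, `t⁻¹ ∤ g`,
  `g = f tᵃ`, exists as soon as `f ∉ Iₙ` for some `n`; weighted-chart spelling `exists_tInv_primitive_factorisation_weighted`;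
* `weightedMonomialIdeal_le_maximalIdeal_pow_div` — in a local ring with all `uᵢ ∈ 𝔪` and weights `≤ W`:
  `(u^α : w·α ≥ n) ⊆ 𝔪^(n / W)` (so `f ∉ 𝔪ᵏ` gives `f ∉ 𝒥_{kW}`).

Def-free helper (`--supports stmt-ResolutionOfSingularities-19897`); OURS bookkeeping — nothing here is a claim about resolution of
singularities in positive characteristic.  AI-written; weaker than expert review. [cite: Wlodarczyk2022, Def. 2.3.5; §3.3; Def. 5.1.1]
-/

noncomputable section

set_option linter.dupNamespace false -- mandated namespace of this single-conjunct summit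

open IsLocalRing
open scoped LaurentPolynomial
open LaurentPolynomial
open Literature.AlgebraicGeometry.Resolution

namespace Summit.ResolutionOfSingularities.ResolutionOfSingularities.Theorems.AQSHeightTwo

universe u

variable {A : Type u} [CommRing A]

/-- **`f ∈ Iₐ ⇒ f = (t⁻¹)ᵃ · (f tᵃ)` in `A[t⁻¹, Iₙ tⁿ]`.** [cite: Wlodarczyk2022, §3.3] -/
theorem _root_.Literature.AlgebraicGeometry.Resolution.extReesAlgebra.exists_eq_tInv_pow_mul_of_mem (I : ℕ → Ideal A)
    {f : A} {a : ℕ} (ha : f ∈ I a) :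
    ∃ g : extReesAlgebra I, (g : A[T;T⁻¹]) = C f * T (a : ℤ) ∧
      algebraMap A (extReesAlgebra I) f = extReesAlgebra.tInv I ^ a * g := by
  have hmem : C f * T (a : ℤ) ∈ extReesAlgebra I := by
    rcases Nat.eq_zero_or_pos a with rfl | hpos
    · rw [Nat.cast_zero, T_zero, mul_one, C_eq_algebraMap]
      exact Subalgebra.algebraMap_mem _ f
    · exact extReesAlgebra.C_mul_T_mem I hpos ha
  refine ⟨⟨_, hmem⟩, rfl, Subtype.ext ?_⟩
  rw [Subalgebra.coe_algebraMap, ← C_eq_algebraMap, Subalgebra.coe_mul, Subalgebra.coe_pow, extReesAlgebra.coe_tInv,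
    T_pow, mul_left_comm, ← T_add]
  have h0 : (a : ℤ) * (-1) + (a : ℤ) = 0 := by ring
  rw [h0, T_zero, mul_one]

/-- **`f tⁿ ∈ A[t⁻¹, Iₙ tⁿ] ↔ f ∈ Iₙ`** for a descending multiplicative sequence of ideals `I = F.ideal` (`I₀ = A`): read in
the coefficientwise model `⊕ Iₙ tⁿ` (`IdealFiltration.extReesAlgebra_ideal_eq_extendedRees`). [cite: Wlodarczyk2022, Def. 5.1.1] -/
theorem _root_.Literature.AlgebraicGeometry.Resolution.extReesAlgebra.C_mul_T_mem_iff (F : IdealFiltration A)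
    {I : ℕ → Ideal A} (hI : F.ideal = I) (f : A) (n : ℕ) :
    C f * T (n : ℤ) ∈ extReesAlgebra I ↔ f ∈ I n := by
  subst hI
  rw [F.extReesAlgebra_ideal_eq_extendedRees]
  exact F.C_mul_T_mem_extendedRees_iff

/-- **`f ∉ Iₐ₊₁ ⇒ t⁻¹ ∤ f tᵃ`** in `A[t⁻¹, Iₙ tⁿ]` (for `I = F.ideal` descending multiplicative): a quotient `h` with
`f tᵃ = t⁻¹ h` would be `f tᵃ⁺¹ ∈ A[t⁻¹, Iₙ tⁿ]`. [cite: Wlodarczyk2022, §3.3] -/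
theorem _root_.Literature.AlgebraicGeometry.Resolution.extReesAlgebra.not_tInv_dvd_of_not_mem (F : IdealFiltration A)
    {I : ℕ → Ideal A} (hI : F.ideal = I) {f : A} {a : ℕ} (ha' : f ∉ I (a + 1)) {g : extReesAlgebra I}
    (hg : (g : A[T;T⁻¹]) = C f * T (a : ℤ)) : ¬ extReesAlgebra.tInv I ∣ g := by
  rintro ⟨h, hh⟩
  apply ha'
  -- `h = f tᵃ⁺¹` as a Laurent polynomial
  have e : C f * T (a : ℤ) = T (-1) * (h : A[T;T⁻¹]) := by
    rw [← hg, ← extReesAlgebra.coe_tInv I, ← Subalgebra.coe_mul, ← hh]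
  have hcoe : (h : A[T;T⁻¹]) = C f * T ((a + 1 : ℕ) : ℤ) := by
    have h1 : (h : A[T;T⁻¹]) = T 1 * (T (-1) * (h : A[T;T⁻¹])) := by
      rw [← mul_assoc, ← T_add]
      norm_num
    rw [h1, ← e, mul_left_comm, ← T_add, Nat.cast_succ, add_comm (1 : ℤ)]
  have hmem : C f * T ((a + 1 : ℕ) : ℤ) ∈ extReesAlgebra I := hcoe ▸ h.2
  exact (extReesAlgebra.C_mul_T_mem_iff F hI f (a + 1)).mp hmem

/-- If `f ∈ I₀` but `f ∉ Iₙ` for some `n`, then `f ∈ Iₐ` and `f ∉ Iₐ₊₁` for some `a` (no monotonicity needed: the first index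
missing `f`, minus one). [folklore] -/
theorem exists_mem_and_not_mem_succ (I : ℕ → Ideal A) {f : A} (h0 : f ∈ I 0) {n : ℕ} (hn : f ∉ I n) :
    ∃ a : ℕ, f ∈ I a ∧ f ∉ I (a + 1) := by
  classical
  have hex : ∃ k, f ∉ I k := ⟨n, hn⟩
  have hk : f ∉ I (Nat.find hex) := Nat.find_spec hex
  have hkpos : 0 < Nat.find hex := by
    refine Nat.pos_of_ne_zero fun h => ?_
    rw [h] at hk
    exact hk h0
  refine ⟨Nat.find hex - 1, ?_, by rwa [Nat.sub_add_cancel hkpos]⟩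
  have hmin := Nat.find_min hex (show Nat.find hex - 1 < Nat.find hex by omega)
  rwa [not_not] at hmin

/-- **A `t⁻¹`-PRIMITIVE FACTORISATION exists**: for a descending multiplicative sequence `I = F.ideal` (`I₀ = A`) and `f ∉ Iₙ` for
some `n`, there are `a` and `g = f tᵃ ∈ A[t⁻¹, Iₙ tⁿ]` with `f = (t⁻¹)ᵃ g`, `t⁻¹ ∤ g` (`f ∈ Iₐ`, `f ∉ Iₐ₊₁`). [cite: Wlodarczyk2022, §3.3] -/
theorem _root_.Literature.AlgebraicGeometry.Resolution.extReesAlgebra.exists_tInv_primitive_factorisation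
    (F : IdealFiltration A) {I : ℕ → Ideal A} (hI : F.ideal = I) {f : A} {n : ℕ} (hn : f ∉ I n) :
    ∃ (a : ℕ) (g : extReesAlgebra I), f ∈ I a ∧ f ∉ I (a + 1) ∧ (g : A[T;T⁻¹]) = C f * T (a : ℤ) ∧
      algebraMap A (extReesAlgebra I) f = extReesAlgebra.tInv I ^ a * g ∧ ¬ extReesAlgebra.tInv I ∣ g := by
  have h0 : f ∈ I 0 := by
    rw [← hI, F.ideal_zero]
    trivial
  obtain ⟨a, ha, ha'⟩ := exists_mem_and_not_mem_succ I h0 hn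
  obtain ⟨g, hg, hfg⟩ := extReesAlgebra.exists_eq_tInv_pow_mul_of_mem I ha
  exact ⟨a, g, ha, ha', hg, hfg, extReesAlgebra.not_tInv_dvd_of_not_mem F hI ha' hg⟩

/-- The same for the game ring `A[t⁻¹, 𝒥ₙ tⁿ]` of a weighted chart, `𝒥ₙ = (u^α : w·α ≥ n)` (`weightedFiltration`).
[cite: Wlodarczyk2022, Lemma 2.1.12; §3.3] -/
theorem exists_tInv_primitive_factorisation_weighted {m : ℕ} (u : Fin m → A) (w : Fin m → ℕ) {f : A} {n : ℕ}
    (hn : f ∉ weightedMonomialIdeal u w n) :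
    ∃ (a : ℕ) (g : extReesAlgebra (weightedMonomialIdeal u w)),
      f ∈ weightedMonomialIdeal u w a ∧ f ∉ weightedMonomialIdeal u w (a + 1) ∧ (g : A[T;T⁻¹]) = C f * T (a : ℤ) ∧
      algebraMap A (extReesAlgebra (weightedMonomialIdeal u w)) f = extReesAlgebra.tInv (weightedMonomialIdeal u w) ^ a * g ∧
      ¬ extReesAlgebra.tInv (weightedMonomialIdeal u w) ∣ g :=
  extReesAlgebra.exists_tInv_primitive_factorisation (weightedFiltration u w)
    (weightedMonomialIdeal_eq_weightedFiltration_ideal' u w).symm hn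

/-- **`(u^α : w·α ≥ n) ⊆ 𝔪^(n / W)`** in a local ring with all `uᵢ ∈ 𝔪` and weights `wᵢ ≤ W`: a monomial of weight `≥ n` has total
degree `≥ n / W` (so an element outside `𝔪ᵏ` is outside `𝒥_{kW}`, which feeds `exists_tInv_primitive_factorisation`). [folklore] -/
theorem weightedMonomialIdeal_le_maximalIdeal_pow_div [IsLocalRing A] {m : ℕ} {u : Fin m → A}
    (hu : ∀ i, u i ∈ maximalIdeal A) {w : Fin m → ℕ} {W : ℕ} (hW : ∀ i, w i ≤ W) (n : ℕ) :
    weightedMonomialIdeal u w n ≤ maximalIdeal A ^ (n / W) := by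
  rw [weightedMonomialIdeal, Ideal.span_le]
  rintro x ⟨α, hα, rfl⟩
  -- total degree `≥ n / W`
  have hdeg : n / W ≤ ∑ i, α i := by
    rcases Nat.eq_zero_or_pos W with rfl | hWpos
    · simp
    · refine (Nat.div_le_iff_le_mul_add_pred hWpos).mpr ?_
      have h1 : ∑ i, w i * α i ≤ ∑ i, W * α i := Finset.sum_le_sum fun i _ => Nat.mul_le_mul_right _ (hW i)
      rw [← Finset.mul_sum] at h1
      have := hα.trans h1
      rw [mul_comm] at this
      omega
  refine Ideal.pow_le_pow_right hdeg ?_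
  rw [← Finset.prod_pow_eq_pow_sum]
  exact Ideal.prod_mem_prod fun i _ => Ideal.pow_mem_pow (hu i) (α i)

end Summit.ResolutionOfSingularities.ResolutionOfSingularities.Theorems.AQSHeightTwo

end
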